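import Literature.Geometry.Lorentzian.ChartLaplacian
import Literature.Geometry.Lorentzian.Volume
import Literature.Geometry.Lorentzian.InitialData
import HarnessLib

/-!
# Relative `L²` harmonic `1`-forms on a domain of a Riemannian manifold (`ℋ¹_rel(Ω, h)`)

For a smooth Riemannian metric `h` on a manifold `X` (Mathlib's
`Bundle.ContMDiffRiemannianMetric` on `TX`, used through the pseudo-Riemannian API
`PseudoRiemannianMetric.ofRiemannian h` of `Literature/Geometry/Lorentzian/`: Levi-Civita connection
`∇ = (ofRiemannian h).leviCivita` under the standing hypothesis `[(ofRiemannian h).HasLeviCivita]`,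
inverse metric `innerDual`, metric trace `trace`, Riemannian measure `riemannianMeasure h`) and an
open set `Ω ⊆ X`, this file defines

* `PseudoRiemannianMetric.covDerivOneFormAux g α Y Z x = Z(α(Y))(x) - α_x(∇_Z Y)` and the
  **covariant derivative `∇α` of a `1`-form** `PseudoRiemannianMetric.covDerivOneForm g α x`, the
  bilinear form `(Y₀, Z₀) ↦ (∇_{Z₀} α)(Y₀)` on `T_x X` (derivative slot last, the convention of
  `PseudoRiemannianMetric.covDeriv₂`), for any `C^n` pseudo-Riemannian metric `g`, `n ≥ 1` — a real
  tensor at every point where `α` is differentiable (`covDerivOneForm_apply`, O'Neill 1983, Ch. 2,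
  Prop. 2.2 and Thm. 2.15; Ch. 3, Def. 3.16–3.17), additive and homogeneous in `α` there
  (`covDerivOneForm_add`, `covDerivOneForm_smul`), and equal to the Hessian on exact forms
  (`covDerivOneForm_mvfderiv`: `∇(du) = Hess u`);
* `IsRelativeL2HarmonicOneForm h Ω α` and the `ℝ`-submodule
  `relativeL2HarmonicOneForms h Ω = ℋ¹_rel(Ω, h)` of **relative `L²` harmonic `1`-forms** of `Ω`:
  `1`-forms `α` smooth up to the boundary on `closure Ω` with
  (i) `∫_Ω h⁻¹(α, α) dV_h < ∞`, (ii) `dα = 0` on `Ω`, i.e. `∇α` symmetric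
  (`dα = ∑ θⁱ ∧ ∇_{Eᵢ} α`, Carron 2007, §1.1.3 (a)), (iii) `d*α = 0` on `Ω`, i.e. `tr_h ∇α = 0`
  (`d*α = -∑ ι_{Eᵢ} ∇_{Eᵢ} α`, loc. cit.), and (iv) the **relative (Dirichlet) boundary condition**
  `ι*α = 0`: `α` vanishes on tangent vectors of the frontier `∂Ω` (Carron 2007, §1.3, the space
  `ℋᵏ_rel(Ω)` in the proof of Thm. 1.13; Cappell–DeTurck–Gluck–Miller 2006, §2, the space
  `CcCᵖ_D = {ω | dω = 0, δω = 0, ω_tan = 0}` of harmonic fields with Dirichlet boundary condition);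
* its dimension `relativeL2HarmonicOneFormsRank h Ω = dim_ℝ ℋ¹_rel(Ω, h)` (a cardinal) with the
  lower-bound lemmas `le_rank_of_linearIndependent`, `le_finrank_of_linearIndependent`;
* the extension-by-zero constructor `extendByZero Ω α` / `isRelativeL2HarmonicOneForm_extendByZero`
  (membership only sees `α` on `closure Ω`; locality of `∇`,
  `covDerivOneForm_congr_of_eventuallyEq`) and the specialisation
  `InitialDataSet.relativeL2HarmonicOneForms D Ω` to the metric of an initial data set.

Requested by route `HarmonicFluxCensus` of the Final State Conjecture (items FluxFormsLowerBound /
RelativeCLRHodgeBound: on the exterior `Ω` of `m` black holes the capacitary potentials give `m`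
independent members `du_j`, and a Carron-type bound controls `dim ℋ¹_rel(Ω)`), where `X` is a
complete `3`-manifold modelled on `𝓡 3` and `∂Ω` a finite disjoint union of compact embedded
surfaces (outermost MOTSs, `OutermostMOTS.exterior : Opens X`); the definitions are stated for any
model with corners on a finite-dimensional space and any open `Ω`.

## Design

* **Forms on `closure Ω`, extended by zero.** A member is a global covector field
  `α : Π x, T_x X →L[ℝ] ℝ` which vanishes off `closure Ω` (Carron's extension-by-zero map `e`,
  §1.3) and is `C^∞` *within* `closure Ω` at each of its points (smooth up to the boundary, as the
  smooth forms on the compact manifold with boundary of Cappell et al.); so `ℋ¹_rel(Ω, h)` is an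
  honest submodule of `Π x, T_x X →L[ℝ] ℝ` whose `Module.rank` is the dimension of the space of
  forms on `closure Ω` (no freedom off `closure Ω`). Conditions (ii)–(iii) are imposed on the open
  set `Ω`, where members are `C^∞`; the `L²` condition integrates over `Ω`.
* **Boundary condition by curves.** "`v ∈ T_x X` is tangent to `∂Ω`" is rendered without boundary
  charts: (iv) asks `α_{γ 0}(γ'(0)) = 0` for every curve `γ : ℝ → X` differentiable at `0` that
  stays in `frontier Ω` near `0`. When `∂Ω` is an embedded submanifold (the union of the images of
  smooth embeddings `f_j : S_j → X`), these velocities are exactly the vectors `df_j(T S_j)`, so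
  (iv) says `f_j^* α = 0` for all `j` — the printed `ι*α = 0` / `ω_tan = 0`.
* `covDerivOneForm` follows the pattern of `PseudoRiemannianMetric.hessian`/`covDeriv₂`: the unique
  bilinear form agreeing with `covDerivOneFormAux` on `FiberBundle.extend`ed vectors when one exists
  (always, at points of differentiability: `exists_covDerivOneForm_repr`), junk value `0` otherwise.
* Smoothness of `1`-forms is smoothness of the section `oneFormSection α` of the cotangent bundle
  `Hom(TX, ℝ)` (model fibre `E →L[ℝ] ℝ`), verbatim as for the fields of bilinear forms of the
  Lorentzian prelude.
* Not here: no Hodge theory (closedness of the range of `d`, `ℋ¹_rel ≅ H¹₂(Ω, ∂Ω)`, finite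
  dimensionality, Carron's bounds), no exterior calculus on `k`-forms (for boundaryless normed-space
  models see `Literature.Geometry.Kaehler.MForm`, `mextDeriv`, `hodgeLaplacian`).

## References

* G. Carron, *L² harmonic forms on non-compact Riemannian manifolds*, arXiv:0704.3194 (2007),
  §1.1.3 (a)–(b) (`d`, `d*` through `∇`; `ℋᵏ(M) = {α ∈ L², dα = 0, d*α = 0}`), §1.1.3 (e)
  (`ℋᵏ_abs(Ω)`), §1.3, proof of Thm. 1.13 (`ℋᵏ_rel(Ω) = {α ∈ L²(ΛᵏT*Ω), dα = d*α = 0, ι*α = 0}`,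
  extension by zero). [cite key `Carron2007`]
* S. Cappell, D. DeTurck, H. Gluck, E. Y. Miller, *Cohomology of harmonic forms on Riemannian
  manifolds with boundary*, Forum Math. 18 (2006), §2 (`ω_tan`, `Ωᵖ_D`, `CcCᵖ_D`).
  [`CappellEtAl2006`]
* G. Carron, *L²-cohomologie et inégalités de Sobolev*, Math. Ann. 314 (1999). [`Carron1999`]
* B. O'Neill, *Semi-Riemannian geometry* (1983), Ch. 2, Prop. 2.2, Thm. 2.15; Ch. 3,
  Def. 3.16–3.17 (covariant differential of a tensor field). [`ONeill1983`]
-/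

noncomputable section

open Bundle Set Function Filter FiberBundle
open scoped Manifold ContDiff Topology ENNReal

namespace Literature.Geometry.Riemannian

open _root_.MeasureTheory Literature.Geometry.Lorentzian

variable {E : Type*} [NormedAddCommGroup E] [NormedSpace ℝ E] {H : Type*} [TopologicalSpace H]
  {I : ModelWithCorners ℝ E H} {X : Type*} [TopologicalSpace X] [ChartedSpace H X]
  [IsManifold I ∞ X] {n : ℕ∞ω} {x : X}

/-! ### `1`-forms as sections of the cotangent bundle -/

/-- A `1`-form `α` (a covector field `x ↦ α_x ∈ T_x* X`) as a map into the total space of the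
cotangent bundle `T*X = Hom(TX, ℝ)` (model fibre `E →L[ℝ] ℝ`); its smoothness is the smoothness of
this map, exactly as for Mathlib's sections `T% s`. [folklore] -/
abbrev oneFormSection (α : Π x : X, TangentSpace I x →L[ℝ] ℝ) :
    X → TotalSpace (E →L[ℝ] ℝ) (fun y : X ↦ TangentSpace I y →L[ℝ] ℝ) :=
  fun y ↦ TotalSpace.mk' (E →L[ℝ] ℝ) y (α y)

/-- A differentiable `1`-form evaluated on a differentiable vector field is a differentiable
function (Mathlib's `MDifferentiableAt.clm_bundle_apply` with values in the trivial bundle).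
O'Neill 1983, Ch. 2, p. 42 (tensor fields as `𝔉(M)`-multilinear maps). [folklore] -/
theorem mdifferentiableAt_oneForm_apply {α : Π x : X, TangentSpace I x →L[ℝ] ℝ}
    (hα : MDifferentiableAt I (I.prod 𝓘(ℝ, E →L[ℝ] ℝ)) (oneFormSection α) x)
    {Y : Π x : X, TangentSpace I x} (hY : MDiffAt (T% Y) x) :
    MDiffAt (fun y ↦ α y (Y y)) x := by
  have : MDifferentiableAt I (I.prod 𝓘(ℝ, ℝ))
      (fun y ↦ TotalSpace.mk' ℝ (E := Bundle.Trivial X ℝ) y (α y (Y y))) x := by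
    apply MDifferentiableAt.clm_bundle_apply (F₁ := E)
    · exact hα
    · exact hY
  simp only [mdifferentiableAt_totalSpace] at this
  exact this.2

/-! ### The covariant derivative `∇α` of a `1`-form -/

section CovDeriv

variable (g : PseudoRiemannianMetric I n E (TangentSpace I : X → Type _)) [g.HasLeviCivita]

/-- The covariant derivative of a `1`-form as a bare operation on vector fields:
`covDerivOneFormAux g α Y Z x = (∇_Z α)(Y)(x) = Z(α(Y))(x) - α_x(∇_Z Y)` (the product rule for
the tensor derivation `∇_Z`, solved for `∇_Z α`). Prefer the tensor `covDerivOneForm`.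
O'Neill 1983, Ch. 2, Prop. 2.13 and Ch. 3, Def. 3.16 (`(D_V θ)(Y) = V(θY) - θ(D_V Y)`).
[cite: ONeill1983, Ch. 3, Def. 3.16] -/
def _root_.Literature.Geometry.Lorentzian.PseudoRiemannianMetric.covDerivOneFormAux
    (α : Π x : X, TangentSpace I x →L[ℝ] ℝ) (Y Z : Π x : X, TangentSpace I x) (x : X) : ℝ :=
  mvfderiv I (fun y ↦ α y (Y y)) x (Z x) - α x (g.leviCivita Y x (Z x))

open scoped Classical in
/-- The **covariant derivative `∇α` of a `1`-form** `α` at `x`, as a bilinear form on `T_x X` with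
`covDerivOneForm g α x Y₀ Z₀ = (∇_{Z₀} α)(Y₀)` (derivative slot last, as for `covDeriv₂`): the
unique bilinear form agreeing with `covDerivOneFormAux g α` on extended tangent vectors when one
exists (always, if `α` is differentiable at `x`: `covDerivOneForm_apply`), junk value `0`
otherwise. Its antisymmetric part is `-dα` and its metric trace is `-d*α` (Carron 2007,
§1.1.3 (a)). O'Neill 1983, Ch. 3, Def. 3.17 (covariant differential of a `(0,1)` tensor).
[cite: ONeill1983, Ch. 3, Def. 3.17] -/
def _root_.Literature.Geometry.Lorentzian.PseudoRiemannianMetric.covDerivOneForm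
    (α : Π x : X, TangentSpace I x →L[ℝ] ℝ) (x : X) : LinearMap.BilinForm ℝ (TangentSpace I x) :=
  if h : ∃ B : LinearMap.BilinForm ℝ (TangentSpace I x), ∀ Y₀ Z₀ : TangentSpace I x,
      B Y₀ Z₀ = g.covDerivOneFormAux α (extend E Y₀) (extend E Z₀) x
  then h.choose else 0

variable {g}

/-- A bilinear form agreeing with `covDerivOneFormAux g α` on extended vectors *is* `∇α_x` (such a
form is unique). [folklore] -/
theorem covDerivOneForm_eq_of_forall {α : Π x : X, TangentSpace I x →L[ℝ] ℝ}
    {B : LinearMap.BilinForm ℝ (TangentSpace I x)}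
    (hB : ∀ Y₀ Z₀, B Y₀ Z₀ = g.covDerivOneFormAux α (extend E Y₀) (extend E Z₀) x) :
    g.covDerivOneForm α x = B := by
  have hex : ∃ B' : LinearMap.BilinForm ℝ (TangentSpace I x), ∀ Y₀ Z₀ : TangentSpace I x,
      B' Y₀ Z₀ = g.covDerivOneFormAux α (extend E Y₀) (extend E Z₀) x := ⟨B, hB⟩
  have h1 : g.covDerivOneForm α x = hex.choose := by
    simp only [PseudoRiemannianMetric.covDerivOneForm, dif_pos hex]
  rw [h1]
  exact LinearMap.ext₂ fun Y₀ Z₀ ↦ (hex.choose_spec Y₀ Z₀).trans (hB Y₀ Z₀).symm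

/-- `∇0 = 0`. [folklore] -/
theorem covDerivOneForm_zero (x : X) :
    g.covDerivOneForm (0 : Π x : X, TangentSpace I x →L[ℝ] ℝ) x = 0 :=
  covDerivOneForm_eq_of_forall fun Y₀ Z₀ ↦ by
    simp [PseudoRiemannianMetric.covDerivOneFormAux, mvfderiv_const]

/-- **`∇α_x` depends only on the germ of `α` at `x`** (locality of `∇`; Mathlib's
`Filter.EventuallyEq.mfderiv_eq` through `mvfderiv_congr_of_eventuallyEq`). O'Neill 1983, Ch. 2,
Prop. 2.2 ff. [folklore] -/
theorem covDerivOneForm_congr_of_eventuallyEq {α β : Π x : X, TangentSpace I x →L[ℝ] ℝ}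
    (hαβ : ∀ᶠ y in 𝓝 x, α y = β y) : g.covDerivOneForm α x = g.covDerivOneForm β x := by
  have haux : ∀ Y Z : Π x : X, TangentSpace I x,
      g.covDerivOneFormAux α Y Z x = g.covDerivOneFormAux β Y Z x := by
    intro Y Z
    have h1 : (fun y ↦ α y (Y y)) =ᶠ[𝓝 x] fun y ↦ β y (Y y) :=
      hαβ.mono fun y hy ↦ by simp only [hy]
    simp only [PseudoRiemannianMetric.covDerivOneFormAux, mvfderiv_congr_of_eventuallyEq h1,
      hαβ.self_of_nhds]
  by_cases hex : ∃ B : LinearMap.BilinForm ℝ (TangentSpace I x), ∀ Y₀ Z₀ : TangentSpace I x,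
      B Y₀ Z₀ = g.covDerivOneFormAux β (extend E Y₀) (extend E Z₀) x
  · obtain ⟨B, hB⟩ := hex
    rw [covDerivOneForm_eq_of_forall hB]
    exact covDerivOneForm_eq_of_forall fun Y₀ Z₀ ↦ (hB Y₀ Z₀).trans (haux _ _).symm
  · have hex' : ¬ ∃ B : LinearMap.BilinForm ℝ (TangentSpace I x), ∀ Y₀ Z₀ : TangentSpace I x,
        B Y₀ Z₀ = g.covDerivOneFormAux α (extend E Y₀) (extend E Z₀) x := by
      rintro ⟨B, hB⟩
      exact hex ⟨B, fun Y₀ Z₀ ↦ (hB Y₀ Z₀).trans (haux _ _)⟩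
    simp only [PseudoRiemannianMetric.covDerivOneForm, dif_neg hex, dif_neg hex']

/-- **`(∇_Z α)(Y)` is tensorial in `Y`** at `x`, for `α` differentiable at `x` (any `Z`):
`Z(α(fY)) - α(∇_Z (fY)) = (Zf) α(Y) + f Z(α(Y)) - f α(∇_Z Y) - (Zf) α(Y)`, by the product rule
(Mathlib's `mvfderiv_mul`) and the Leibniz rule of the connection; the `(Zf)`-terms cancel.
O'Neill 1983, Ch. 2, proof of Thm. 2.15 (p. 48). [cite: ONeill1983, Ch. 2, Thm. 2.15] -/
theorem tensorialAt_covDerivOneFormAux₁ {α : Π x : X, TangentSpace I x →L[ℝ] ℝ}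
    (hα : MDifferentiableAt I (I.prod 𝓘(ℝ, E →L[ℝ] ℝ)) (oneFormSection α) x)
    (Z : Π x : X, TangentSpace I x) :
    TensorialAt I E (fun Y ↦ g.covDerivOneFormAux α Y Z x) x where
  smul {f Y} hf hY := by
    have e1 : (fun y ↦ α y ((f • Y) y)) = f * fun y ↦ α y (Y y) := by
      funext y; simp [Pi.smul_apply', map_smul, smul_eq_mul]
    have hl : g.leviCivita (f • Y) x =
        f x • g.leviCivita Y x + (mvfderiv I f x).smulRight (Y x) :=
      g.leviCivita.isCovariantDerivativeOnUniv.leibniz hY hf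
    simp only [PseudoRiemannianMetric.covDerivOneFormAux]
    rw [e1, mvfderiv_mul hf (mdifferentiableAt_oneForm_apply hα hY), hl]
    simp only [add_apply, smul_apply, ContinuousLinearMap.smulRight_apply, map_add, map_smul,
      smul_eq_mul]
    ring
  add {Y Y'} hY hY' := by
    have e1 : (fun y ↦ α y ((Y + Y') y)) = (fun y ↦ α y (Y y)) + fun y ↦ α y (Y' y) := by
      funext y; simp [map_add]
    have hl : g.leviCivita (Y + Y') x = g.leviCivita Y x + g.leviCivita Y' x :=
      g.leviCivita.isCovariantDerivativeOnUniv.add hY hY'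
    simp only [PseudoRiemannianMetric.covDerivOneFormAux]
    rw [e1, mvfderiv_add (mdifferentiableAt_oneForm_apply hα hY)
      (mdifferentiableAt_oneForm_apply hα hY'), hl]
    simp only [add_apply, map_add]
    ring

/-- **`(∇_Z α)(Y)` is tensorial in the derivative slot `Z`** (it involves `Z` only through `Z x`,
linearly). O'Neill 1983, Ch. 3, Def. 3.17 ("(D1)"). [cite: ONeill1983, Ch. 3, Def. 3.17] -/
theorem tensorialAt_covDerivOneFormAux₂ (α : Π x : X, TangentSpace I x →L[ℝ] ℝ)
    (Y : Π x : X, TangentSpace I x) :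
    TensorialAt I E (fun Z ↦ g.covDerivOneFormAux α Y Z x) x where
  smul {f Z} _ _ := by
    simp only [PseudoRiemannianMetric.covDerivOneFormAux, Pi.smul_apply', map_smul, smul_eq_mul]
    ring
  add {Z Z'} _ _ := by
    simp only [PseudoRiemannianMetric.covDerivOneFormAux, Pi.add_apply, map_add]
    ring

variable [FiniteDimensional ℝ E]

/-- `(∇_Z α)(Y)(x)` depends on the differentiable field `Y` and on `Z` only through `Y x`, `Z x`
(Mathlib's `TensorialAt.pointwise`); it may be computed on the extended vectors.
O'Neill 1983, Ch. 2, Prop. 2.2 (tensors are pointwise). [cite: ONeill1983, Ch. 2, Prop. 2.2] -/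
theorem covDerivOneFormAux_apply_eq_extend {α : Π x : X, TangentSpace I x →L[ℝ] ℝ}
    (hα : MDifferentiableAt I (I.prod 𝓘(ℝ, E →L[ℝ] ℝ)) (oneFormSection α) x)
    {Y : Π x : X, TangentSpace I x} (hY : MDiffAt (T% Y) x) (Z : Π x : X, TangentSpace I x) :
    g.covDerivOneFormAux α Y Z x =
      g.covDerivOneFormAux α (extend E (Y x)) (extend E (Z x)) x := by
  have hZ : g.covDerivOneFormAux α (extend E (Y x)) (extend E (Z x)) x =
      g.covDerivOneFormAux α (extend E (Y x)) Z x := by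
    simp only [PseudoRiemannianMetric.covDerivOneFormAux, extend_apply_self]
  rw [hZ]
  exact (tensorialAt_covDerivOneFormAux₁ hα Z).pointwise hY (mdifferentiableAt_extend ..) (by simp)

/-- **Representability of `∇α` at `x`** for `α` differentiable at `x`: a bilinear form on `T_x X`
agrees with `covDerivOneFormAux g α` on extended vectors (the two tensorialities and Mathlib's
`TensorialAt.mkHom₂`). O'Neill 1983, Ch. 2, Prop. 2.2 and Thm. 2.15.
[cite: ONeill1983, Ch. 2, Thm. 2.15] -/
theorem exists_covDerivOneForm_repr {α : Π x : X, TangentSpace I x →L[ℝ] ℝ}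
    (hα : MDifferentiableAt I (I.prod 𝓘(ℝ, E →L[ℝ] ℝ)) (oneFormSection α) x) :
    ∃ B : LinearMap.BilinForm ℝ (TangentSpace I x), ∀ Y₀ Z₀ : TangentSpace I x,
      B Y₀ Z₀ = g.covDerivOneFormAux α (extend E Y₀) (extend E Z₀) x := by
  have hΦ₁ : ∀ τ : Π x : X, TangentSpace I x, MDiffAt (T% τ) x →
      TensorialAt I E (fun σ ↦ g.covDerivOneFormAux α σ τ x) x :=
    fun τ _ ↦ tensorialAt_covDerivOneFormAux₁ hα τ
  have hΦ₂ : ∀ σ : Π x : X, TangentSpace I x, MDiffAt (T% σ) x →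
      TensorialAt I E (fun τ ↦ g.covDerivOneFormAux α σ τ x) x :=
    fun σ _ ↦ tensorialAt_covDerivOneFormAux₂ α σ
  let K : TangentSpace I x →L[ℝ] TangentSpace I x →L[ℝ] ℝ :=
    TensorialAt.mkHom₂ (fun σ τ ↦ g.covDerivOneFormAux α σ τ x) x hΦ₁ hΦ₂
  refine ⟨K.toLinearMap₁₂, fun Y₀ Z₀ ↦ ?_⟩
  simp only [ContinuousLinearMap.toLinearMap₁₂_apply, K]
  exact TensorialAt.mkHom₂_apply_eq_extend hΦ₁ hΦ₂ Y₀ Z₀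

/-- **`∇α` evaluates by the classical formula**: for `α` differentiable at `x`, `Y` differentiable
at `x` and any `Z`, `(∇α)_x(Y_x, Z_x) = Z(α(Y))(x) - α_x(∇_Z Y)`. O'Neill 1983, Ch. 3,
Def. 3.16–3.17 with Ch. 2, Prop. 2.2. [cite: ONeill1983, Ch. 3, Def. 3.16–3.17] -/
theorem covDerivOneForm_apply {α : Π x : X, TangentSpace I x →L[ℝ] ℝ}
    (hα : MDifferentiableAt I (I.prod 𝓘(ℝ, E →L[ℝ] ℝ)) (oneFormSection α) x)
    {Y : Π x : X, TangentSpace I x} (hY : MDiffAt (T% Y) x) (Z : Π x : X, TangentSpace I x) :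
    g.covDerivOneForm α x (Y x) (Z x) = g.covDerivOneFormAux α Y Z x := by
  obtain ⟨B, hB⟩ := exists_covDerivOneForm_repr (g := g) hα
  rw [covDerivOneForm_eq_of_forall hB, hB, ← covDerivOneFormAux_apply_eq_extend hα hY Z]

/-- `∇(α + β) = ∇α + ∇β` at points where `α`, `β` are differentiable. O'Neill 1983, Ch. 3,
Def. 3.16 ((D2): `D_V` is `ℝ`-linear). [cite: ONeill1983, Ch. 3, Def. 3.16] -/
theorem covDerivOneForm_add {α β : Π x : X, TangentSpace I x →L[ℝ] ℝ}
    (hα : MDifferentiableAt I (I.prod 𝓘(ℝ, E →L[ℝ] ℝ)) (oneFormSection α) x)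
    (hβ : MDifferentiableAt I (I.prod 𝓘(ℝ, E →L[ℝ] ℝ)) (oneFormSection β) x) :
    g.covDerivOneForm (α + β) x = g.covDerivOneForm α x + g.covDerivOneForm β x := by
  obtain ⟨A, hA⟩ := exists_covDerivOneForm_repr (g := g) hα
  obtain ⟨B, hB⟩ := exists_covDerivOneForm_repr (g := g) hβ
  rw [covDerivOneForm_eq_of_forall hA, covDerivOneForm_eq_of_forall hB]
  refine covDerivOneForm_eq_of_forall fun Y₀ Z₀ ↦ ?_
  have e1 : (fun y ↦ (α + β) y (extend E Y₀ y)) =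
      (fun y ↦ α y (extend E Y₀ y)) + fun y ↦ β y (extend E Y₀ y) := by
    funext y; simp
  rw [LinearMap.add_apply, LinearMap.add_apply, hA, hB]
  simp only [PseudoRiemannianMetric.covDerivOneFormAux]
  rw [e1, mvfderiv_add (mdifferentiableAt_oneForm_apply hα (mdifferentiableAt_extend ..))
    (mdifferentiableAt_oneForm_apply hβ (mdifferentiableAt_extend ..))]
  simp only [add_apply, Pi.add_apply]
  ring

/-- `∇(c α) = c ∇α` at points where `α` is differentiable. O'Neill 1983, Ch. 3, Def. 3.16 ((D2)).
[cite: ONeill1983, Ch. 3, Def. 3.16] -/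
theorem covDerivOneForm_smul {α : Π x : X, TangentSpace I x →L[ℝ] ℝ}
    (hα : MDifferentiableAt I (I.prod 𝓘(ℝ, E →L[ℝ] ℝ)) (oneFormSection α) x) (c : ℝ) :
    g.covDerivOneForm (c • α) x = c • g.covDerivOneForm α x := by
  obtain ⟨A, hA⟩ := exists_covDerivOneForm_repr (g := g) hα
  rw [covDerivOneForm_eq_of_forall hA]
  refine covDerivOneForm_eq_of_forall fun Y₀ Z₀ ↦ ?_
  have e1 : (fun y ↦ (c • α) y (extend E Y₀ y)) = (fun _ ↦ c) * fun y ↦ α y (extend E Y₀ y) := by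
    funext y; simp
  rw [LinearMap.smul_apply, LinearMap.smul_apply, hA]
  simp only [PseudoRiemannianMetric.covDerivOneFormAux]
  rw [e1, mvfderiv_mul mdifferentiableAt_const
    (mdifferentiableAt_oneForm_apply hα (mdifferentiableAt_extend ..)), mvfderiv_const]
  simp only [add_apply, smul_apply, zero_apply, Pi.smul_apply, smul_eq_mul]
  ring

variable [CompleteSpace E] [Fact (1 ≤ n)]

/-- **`∇(du) = Hess u`**: for `u` of class `C²` at `x`, the covariant derivative of the exact form
`du = mvfderiv I u` at `x` is the Hessian of `u` (`covDerivOneFormAux g (du) Y Z` is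
`hessianAux g u Z Y` by `rfl`, and the Hessian is symmetric, `hessian_symm_holds`). Hence `du` is
closed, and `tr_h ∇(du) = □_h u` (`trace_covDerivOneForm_mvfderiv`). O'Neill 1983, Ch. 3,
Def. 3.48–3.49 (`H^u = D(Du)`). [cite: ONeill1983, Ch. 3, Def. 3.48–Lemma 3.49] -/
theorem covDerivOneForm_mvfderiv {u : X → ℝ} (hu : CMDiffAt 2 u x) :
    g.covDerivOneForm (mvfderiv I u) x = g.hessian u x := by
  refine covDerivOneForm_eq_of_forall fun Y₀ Z₀ ↦ ?_
  rw [(PseudoRiemannianMetric.hessian_symm_holds (g := g) hu).eq Y₀ Z₀]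
  have h := PseudoRiemannianMetric.hessian_apply_holds (g := g) hu
    (mdifferentiableAt_extend (x := x) I E Z₀) (mdifferentiableAt_extend (x := x) I E Y₀)
  simp only [extend_apply_self] at h
  exact h

/-- `tr_h ∇(du) = □_h u` (the Laplace–Beltrami operator) for `u` of class `C²` at `x`; so `du`
is coclosed iff `u` is harmonic. O'Neill 1983, Ch. 3, Def. 3.50 ff.
[cite: ONeill1983, Ch. 3, Def. 3.50] -/
theorem trace_covDerivOneForm_mvfderiv {u : X → ℝ} (hu : CMDiffAt 2 u x) :
    g.trace x (g.covDerivOneForm (mvfderiv I u) x) = g.dalembertian u x := by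
  rw [covDerivOneForm_mvfderiv hu]
  rfl

/-- **Exact forms are closed**: `∇(du)` is symmetric for `u` of class `C²` at `x` (`d(du) = 0`;
symmetry of the Hessian, i.e. torsion-freeness of `∇`). O'Neill 1983, Ch. 3, Lemma 3.49.
[cite: ONeill1983, Ch. 3, Lemma 3.49] -/
theorem isSymm_covDerivOneForm_mvfderiv {u : X → ℝ} (hu : CMDiffAt 2 u x) :
    (g.covDerivOneForm (mvfderiv I u) x).IsSymm := by
  rw [covDerivOneForm_mvfderiv hu]
  exact PseudoRiemannianMetric.hessian_symm_holds (g := g) hu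

end CovDeriv

/-! ### Continuity of the inverse metric on continuous `1`-forms -/

/-- For `1`-forms `α`, `β` that are `C^m` within `s` at `x` (as sections of `T*X`) and a smooth
metric `g`, the scalar function `p ↦ g⁻¹_p(α_p, β_p)` is continuous within `s` at `x`: in the
coordinate frame `∂ᵢ` of the chart at `x`, `g⁻¹(α, β) = ∑ gᵏˡ β(∂ₖ) α(∂ₗ)`
(`innerDual_eq_sum_localFrame`) with `gᵏˡ` smooth (`contMDiffOn_gram_localFrame_inv`) and
`p ↦ α_p(∂ₗ|_p)` continuous within `s` (Mathlib's `ContMDiffWithinAt.clm_bundle_apply`).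
O'Neill 1983, Ch. 3, p. 60. [folklore] -/
theorem continuousWithinAt_innerDual_oneForm [FiniteDimensional ℝ E]
    (g : PseudoRiemannianMetric I ∞ E (TangentSpace I : X → Type _)) {m : ℕ∞ω} {s : Set X}
    {α β : Π x : X, TangentSpace I x →L[ℝ] ℝ}
    (hα : ContMDiffWithinAt I (I.prod 𝓘(ℝ, E →L[ℝ] ℝ)) m (oneFormSection α) s x)
    (hβ : ContMDiffWithinAt I (I.prod 𝓘(ℝ, E →L[ℝ] ℝ)) m (oneFormSection β) s x) :
    ContinuousWithinAt (fun p ↦ g.innerDual p (α p).toLinearMap (β p).toLinearMap) s x := by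
  classical
  set e := trivializationAt E (TangentSpace I) x
  set bE := Module.finBasis ℝ E
  have hxe : x ∈ e.baseSet := FiberBundle.mem_baseSet_trivializationAt' x
  have hpair : ∀ {θ : Π x : X, TangentSpace I x →L[ℝ] ℝ},
      ContMDiffWithinAt I (I.prod 𝓘(ℝ, E →L[ℝ] ℝ)) m (oneFormSection θ) s x →
      ∀ i, ContinuousWithinAt (fun p ↦ θ p (e.localFrame bE i p)) s x := by
    intro θ hθ i
    have hfr : CMDiffAt 0 (T% (e.localFrame bE i)) x :=
      (contMDiffAt_localFrame_of_mem ∞ e bE i hxe).of_le bot_le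
    have : ContMDiffWithinAt I (I.prod 𝓘(ℝ, ℝ)) 0
        (fun p ↦ TotalSpace.mk' ℝ (E := Bundle.Trivial X ℝ) p (θ p (e.localFrame bE i p))) s x := by
      apply ContMDiffWithinAt.clm_bundle_apply (F₁ := E)
      · exact hθ.of_le bot_le
      · exact hfr.contMDiffWithinAt
    simp only [contMDiffWithinAt_totalSpace] at this
    exact this.2.continuousWithinAt
  have hGinv : ∀ k l, ContinuousWithinAt (fun p ↦ (Matrix.of fun i j ↦
      g.val p (e.localFrame bE i p) (e.localFrame bE j p))⁻¹ k l) s x := fun k l ↦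
    ((contMDiffOn_gram_localFrame_inv e g bE k l x hxe).contMDiffAt
      (e.open_baseSet.mem_nhds hxe)).continuousAt.continuousWithinAt
  have hsum : ContinuousWithinAt (fun p ↦ ∑ l, ∑ k, (Matrix.of fun i j ↦
      g.val p (e.localFrame bE i p) (e.localFrame bE j p))⁻¹ k l *
        β p (e.localFrame bE k p) * α p (e.localFrame bE l p)) s x :=
    tendsto_finsetSum _ fun l _ ↦ tendsto_finsetSum _ fun k _ ↦
      ((hGinv k l).mul (hpair hβ k)).mul (hpair hα l)
  have hsrc : ∀ᶠ p in 𝓝[s] x, p ∈ (chartAt H x).source :=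
    mem_nhdsWithin_of_mem_nhds ((chartAt H x).open_source.mem_nhds (mem_chart_source H x))
  refine hsum.congr_of_eventuallyEq ?_ (innerDual_eq_sum_localFrame g bE (mem_chart_source H x) _ _)
  filter_upwards [hsrc] with p hp
  exact innerDual_eq_sum_localFrame g bE hp _ _

/-! ### Relative `L²` harmonic `1`-forms -/

section Relative

variable [FiniteDimensional ℝ E] [T3Space X] [MeasurableSpace X] [BorelSpace X]
  (h : ContMDiffRiemannianMetric I ∞ E (TangentSpace I : X → Type _))
  [(PseudoRiemannianMetric.ofRiemannian h).HasLeviCivita] (Ω : TopologicalSpace.Opens X)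

/-- `α` is a **relative `L²` harmonic `1`-form of the open set `Ω ⊆ X`** (a member of
`ℋ¹_rel(Ω, h)`, viewed on `X` through extension by zero): `α` vanishes off `closure Ω`, is `C^∞`
within `closure Ω` at every point of `closure Ω` (smooth up to the boundary), and
(i) `∫_Ω h⁻¹(α, α) dV_h < ∞`; (ii) `dα = 0` on `Ω`: `(∇_v α)(w) = (∇_w α)(v)`, i.e. `∇α`
symmetric; (iii) `d*α = 0` on `Ω`: `tr_h ∇α = 0`; (iv) `ι*α = 0` on `∂Ω`: `α_{γ(0)}(γ'(0)) = 0`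
for every curve `γ` differentiable at `0` staying in `frontier Ω` near `0`.
Carron 2007, §1.3 (proof of Thm. 1.13: `ℋᵏ_rel(Ω) = {α ∈ L²(ΛᵏT*Ω), dα = d*α = 0, ι*α = 0}`),
with `d`, `d*` through `∇` as in §1.1.3 (a); Cappell–DeTurck–Gluck–Miller 2006, §2 (`CcCᵖ_D`).
[cite: Carron2007, §1.3, proof of Thm. 1.13] -/
structure IsRelativeL2HarmonicOneForm (α : Π x : X, TangentSpace I x →L[ℝ] ℝ) : Prop where
  /-- `α` is extended by zero off `closure Ω`. -/
  eq_zero : ∀ x ∉ closure (Ω : Set X), α x = 0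
  /-- `α` is smooth up to the boundary on `closure Ω`. -/
  contMDiffWithinAt : ∀ x ∈ closure (Ω : Set X),
    ContMDiffWithinAt I (I.prod 𝓘(ℝ, E →L[ℝ] ℝ)) ∞ (oneFormSection α) (closure (Ω : Set X)) x
  /-- (i) `α ∈ L²`: `∫_Ω h⁻¹(α, α) dV_h < ∞`. -/
  lintegral_lt_top : ∫⁻ x in (Ω : Set X), ENNReal.ofReal
    ((PseudoRiemannianMetric.ofRiemannian h).innerDual x (α x).toLinearMap (α x).toLinearMap)
      ∂(riemannianMeasure h) < ⊤
  /-- (ii) `dα = 0` on `Ω`: `∇α` is symmetric. -/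
  isSymm : ∀ x ∈ (Ω : Set X), ((PseudoRiemannianMetric.ofRiemannian h).covDerivOneForm α x).IsSymm
  /-- (iii) `d*α = 0` on `Ω`: `tr_h ∇α = 0`. -/
  trace_eq_zero : ∀ x ∈ (Ω : Set X), (PseudoRiemannianMetric.ofRiemannian h).trace x
    ((PseudoRiemannianMetric.ofRiemannian h).covDerivOneForm α x) = 0
  /-- (iv) relative (Dirichlet) boundary condition `ι*α = 0`: `α` kills velocities of curves in
  `∂Ω`. -/
  boundary : ∀ γ : ℝ → X, MDifferentiableAt 𝓘(ℝ, ℝ) I γ 0 →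
    (∀ᶠ t in 𝓝 (0 : ℝ), γ t ∈ frontier (Ω : Set X)) → α (γ 0) (mfderiv 𝓘(ℝ, ℝ) I γ 0 1) = 0

variable {h Ω}

omit [T3Space X] [MeasurableSpace X] [BorelSpace X]
  [(PseudoRiemannianMetric.ofRiemannian h).HasLeviCivita] in
/-- `h⁻¹(γ, γ) ≥ 0` for a Riemannian metric (`h⁻¹(γ, γ) = h(♯γ, ♯γ)`). [folklore] -/
theorem innerDual_self_nonneg (x : X) (γ : Module.Dual ℝ (TangentSpace I x)) :
    0 ≤ (PseudoRiemannianMetric.ofRiemannian h).innerDual x γ γ := by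
  rw [PseudoRiemannianMetric.innerDual_eq_val_sharp_sharp,
    PseudoRiemannianMetric.val_ofRiemannian]
  by_cases hv : (PseudoRiemannianMetric.ofRiemannian h).sharp x γ = 0
  · simp [hv]
  · exact (h.pos x _ hv).le

omit [T3Space X] [MeasurableSpace X] [BorelSpace X]
  [(PseudoRiemannianMetric.ofRiemannian h).HasLeviCivita] in
/-- `h⁻¹(a + b, a + b) ≤ 2 h⁻¹(a, a) + 2 h⁻¹(b, b)` (from `0 ≤ h⁻¹(a - b, a - b)`). [folklore] -/
theorem innerDual_add_self_le (x : X) (a b : Module.Dual ℝ (TangentSpace I x)) :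
    (PseudoRiemannianMetric.ofRiemannian h).innerDual x (a + b) (a + b) ≤
      2 * (PseudoRiemannianMetric.ofRiemannian h).innerDual x a a +
        2 * (PseudoRiemannianMetric.ofRiemannian h).innerDual x b b := by
  have h0 := innerDual_self_nonneg (h := h) x (a - b)
  have hs := (PseudoRiemannianMetric.ofRiemannian h).innerDual_comm x a b
  simp only [PseudoRiemannianMetric.innerDual, map_add, map_sub, LinearMap.add_apply,
    LinearMap.sub_apply] at h0 hs ⊢
  linarith

/-- On `Ω`, `p ↦ h⁻¹(α_p, α_p)` is continuous for a member `α`, hence a.e.-measurable for the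
Riemannian measure restricted to `Ω`. [folklore] -/
theorem IsRelativeL2HarmonicOneForm.aemeasurable {α β : Π x : X, TangentSpace I x →L[ℝ] ℝ}
    (hα : IsRelativeL2HarmonicOneForm h Ω α) (hβ : IsRelativeL2HarmonicOneForm h Ω β) :
    AEMeasurable (fun p ↦ ENNReal.ofReal ((PseudoRiemannianMetric.ofRiemannian h).innerDual p
      (α p).toLinearMap (β p).toLinearMap)) ((riemannianMeasure h).restrict (Ω : Set X)) := by
  refine (ContinuousOn.aemeasurable (fun p hp ↦ ?_) Ω.isOpen.measurableSet).ennreal_ofReal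
  exact (continuousWithinAt_innerDual_oneForm _ (hα.contMDiffWithinAt p (subset_closure hp))
    (hβ.contMDiffWithinAt p (subset_closure hp))).mono subset_closure

/-- A member of `ℋ¹_rel(Ω, h)` is `C^∞` at every point of the open set `Ω`. [folklore] -/
theorem IsRelativeL2HarmonicOneForm.contMDiffAt {α : Π x : X, TangentSpace I x →L[ℝ] ℝ}
    (hα : IsRelativeL2HarmonicOneForm h Ω α) (hx : x ∈ (Ω : Set X)) :
    ContMDiffAt I (I.prod 𝓘(ℝ, E →L[ℝ] ℝ)) ∞ (oneFormSection α) x :=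
  (hα.contMDiffWithinAt x (subset_closure hx)).contMDiffAt
    (mem_of_superset (Ω.isOpen.mem_nhds hx) subset_closure)

variable (h Ω) in
/-- **The space `ℋ¹_rel(Ω, h)` of relative `L²` harmonic `1`-forms** of the open set `Ω ⊆ X`, as
an `ℝ`-submodule of the covector fields on `X` (members extended by zero off `closure Ω`):
`L²` forms, smooth up to the boundary, closed and coclosed on `Ω`, with vanishing tangential part
on `∂Ω` (`IsRelativeL2HarmonicOneForm`). For `Ω` the exterior of a compact set with smooth boundary
in a complete manifold it is isomorphic to the relative reduced `L²` cohomology `H¹₂(Ω, ∂Ω)`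
(Carron 2007, §1.3); for compact `closure Ω` it is `CcC¹_D ≅ H¹(Ω̄, ∂Ω; ℝ)` (Cappell et al. 2006,
§2, Hodge Decomposition Theorem). Carron 2007, §1.3, proof of Thm. 1.13; Cappell–DeTurck–Gluck–
Miller 2006, §2.
[cite: Carron2007, §1.3, proof of Thm. 1.13] -/
def relativeL2HarmonicOneForms : Submodule ℝ (Π x : X, TangentSpace I x →L[ℝ] ℝ) where
  carrier := {α | IsRelativeL2HarmonicOneForm h Ω α}
  zero_mem' := by
    refine ⟨fun _ _ ↦ rfl, fun x _ ↦ ?_, ?_, fun x _ ↦ ?_, fun x _ ↦ ?_, fun _ _ _ ↦ rfl⟩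
    · exact (contMDiffWithinAt_zeroSection ℝ (fun y : X ↦ TangentSpace I y →L[ℝ] ℝ))
    · simp [PseudoRiemannianMetric.innerDual]
    · rw [covDerivOneForm_zero]; exact LinearMap.BilinForm.isSymm_zero
    · simp [covDerivOneForm_zero, PseudoRiemannianMetric.trace]
  add_mem' {α β} hα hβ := by
    refine ⟨fun x hx ↦ by simp [hα.eq_zero x hx, hβ.eq_zero x hx],
      fun x hx ↦ (hα.contMDiffWithinAt x hx).add_section (hβ.contMDiffWithinAt x hx), ?_,
      fun x hx ↦ ?_, fun x hx ↦ ?_,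
      fun γ hγ hγ' ↦ by simp [hα.boundary γ hγ hγ', hβ.boundary γ hγ hγ']⟩
    · -- `L²`: `|α + β|² ≤ 2|α|² + 2|β|²`
      set G := PseudoRiemannianMetric.ofRiemannian h
      have hle : ∀ p,
          ENNReal.ofReal (G.innerDual p ((α + β) p).toLinearMap ((α + β) p).toLinearMap) ≤
          2 * ENNReal.ofReal (G.innerDual p (α p).toLinearMap (α p).toLinearMap) +
            2 * ENNReal.ofReal (G.innerDual p (β p).toLinearMap (β p).toLinearMap) := by
        intro p
        have h2 : ((α + β) p).toLinearMap = (α p).toLinearMap + (β p).toLinearMap := by simp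
        rw [h2, ← ENNReal.ofReal_ofNat 2, ← ENNReal.ofReal_mul (p := 2) (by norm_num),
          ← ENNReal.ofReal_mul (p := 2) (by norm_num)]
        exact (ENNReal.ofReal_le_ofReal (innerDual_add_self_le (h := h) p _ _)).trans
          ENNReal.ofReal_add_le
      refine lt_of_le_of_lt (lintegral_mono hle) ?_
      rw [lintegral_add_left' ((hα.aemeasurable hα).const_mul _),
        lintegral_const_mul' _ _ (by simp), lintegral_const_mul' _ _ (by simp)]
      exact ENNReal.add_lt_top.2 ⟨ENNReal.mul_lt_top (by simp) hα.lintegral_lt_top,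
        ENNReal.mul_lt_top (by simp) hβ.lintegral_lt_top⟩
    · rw [covDerivOneForm_add ((hα.contMDiffAt hx).mdifferentiableAt (by simp))
        ((hβ.contMDiffAt hx).mdifferentiableAt (by simp))]
      exact (hα.isSymm x hx).add (hβ.isSymm x hx)
    · have ha := hα.trace_eq_zero x hx
      have hb := hβ.trace_eq_zero x hx
      simp only [PseudoRiemannianMetric.trace] at ha hb ⊢
      rw [covDerivOneForm_add ((hα.contMDiffAt hx).mdifferentiableAt (by simp))
        ((hβ.contMDiffAt hx).mdifferentiableAt (by simp)), LinearMap.comp_add, map_add, ha, hb,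
        add_zero]
  smul_mem' := by
    intro c α hα
    refine ⟨fun x hx ↦ by simp [hα.eq_zero x hx],
      fun x hx ↦ (hα.contMDiffWithinAt x hx).const_smul_section, ?_, fun x hx ↦ ?_,
      fun x hx ↦ ?_, fun γ hγ hγ' ↦ by simp [hα.boundary γ hγ hγ']⟩
    · set G := PseudoRiemannianMetric.ofRiemannian h
      have heq : ∀ p,
          ENNReal.ofReal (G.innerDual p ((c • α) p).toLinearMap ((c • α) p).toLinearMap) =
            ENNReal.ofReal (c ^ 2) *
              ENNReal.ofReal (G.innerDual p (α p).toLinearMap (α p).toLinearMap) := by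
        intro p
        have h2 : ((c • α) p).toLinearMap = c • (α p).toLinearMap := by simp
        rw [h2, ← ENNReal.ofReal_mul (sq_nonneg c)]
        simp only [PseudoRiemannianMetric.innerDual, map_smul, LinearMap.smul_apply, smul_eq_mul]
        congr 1
        ring
      simp_rw [heq]
      rw [lintegral_const_mul' _ _ ENNReal.ofReal_ne_top]
      exact ENNReal.mul_lt_top ENNReal.ofReal_lt_top hα.lintegral_lt_top
    · rw [covDerivOneForm_smul ((hα.contMDiffAt hx).mdifferentiableAt (by simp))]
      exact (hα.isSymm x hx).smul c
    · have ha := hα.trace_eq_zero x hx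
      simp only [PseudoRiemannianMetric.trace] at ha ⊢
      rw [covDerivOneForm_smul ((hα.contMDiffAt hx).mdifferentiableAt (by simp)),
        LinearMap.comp_smul, map_smul, ha, smul_zero]

/-- Membership in `ℋ¹_rel(Ω, h)` is the predicate `IsRelativeL2HarmonicOneForm`. [folklore] -/
@[simp]
theorem mem_relativeL2HarmonicOneForms_iff {α : Π x : X, TangentSpace I x →L[ℝ] ℝ} :
    α ∈ relativeL2HarmonicOneForms h Ω ↔ IsRelativeL2HarmonicOneForm h Ω α := Iff.rfl

open scoped Classical in
variable (Ω) in
/-- **Extension by zero** of a `1`-form given on (a neighbourhood of) `closure Ω` to all of `X`: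
`α` on `closure Ω`, `0` elsewhere (Carron's map `e : L²(ΛᵏT*Ω) → L²(ΛᵏT*M)`).
Carron 2007, §1.3, proof of Thm. 1.13. [cite: Carron2007, §1.3, proof of Thm. 1.13] -/
def extendByZero (α : Π x : X, TangentSpace I x →L[ℝ] ℝ) : Π x : X, TangentSpace I x →L[ℝ] ℝ :=
  fun x ↦ if x ∈ closure (Ω : Set X) then α x else 0

omit [IsManifold I ∞ X] [FiniteDimensional ℝ E] [T3Space X] [MeasurableSpace X] [BorelSpace X]
  [(PseudoRiemannianMetric.ofRiemannian h).HasLeviCivita] in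
/-- On `closure Ω` the extension by zero is `α`. [folklore] -/
theorem extendByZero_of_mem {α : Π x : X, TangentSpace I x →L[ℝ] ℝ} (hx : x ∈ closure (Ω : Set X)) :
    extendByZero Ω α x = α x := by
  simp [extendByZero, hx]

omit [IsManifold I ∞ X] [FiniteDimensional ℝ E] [T3Space X] [MeasurableSpace X] [BorelSpace X]
  [(PseudoRiemannianMetric.ofRiemannian h).HasLeviCivita] in
/-- Off `closure Ω` the extension by zero vanishes. [folklore] -/
theorem extendByZero_of_not_mem {α : Π x : X, TangentSpace I x →L[ℝ] ℝ}
    (hx : x ∉ closure (Ω : Set X)) : extendByZero Ω α x = 0 := by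
  simp [extendByZero, hx]

/-- **Membership through extension by zero**: a `1`-form `α` (arbitrary off `closure Ω`) which is
`C^∞` within `closure Ω` at its points, `L²` on `Ω`, closed and coclosed on `Ω` and kills the
velocities of curves in `∂Ω` yields the member `extendByZero Ω α` of `ℋ¹_rel(Ω, h)`: every clause
of `IsRelativeL2HarmonicOneForm` only sees `α` on `closure Ω` (`∇` is local,
`covDerivOneForm_congr_of_eventuallyEq`). This is how the differentials `du` of functions harmonic
on `Ω`, smooth up to `∂Ω` and locally constant on `∂Ω` enter `ℋ¹_rel(Ω, h)`.
Carron 2007, §1.3, proof of Thm. 1.13 (extension by zero).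
[cite: Carron2007, §1.3, proof of Thm. 1.13] -/
theorem isRelativeL2HarmonicOneForm_extendByZero {α : Π x : X, TangentSpace I x →L[ℝ] ℝ}
    (hs : ∀ x ∈ closure (Ω : Set X),
      ContMDiffWithinAt I (I.prod 𝓘(ℝ, E →L[ℝ] ℝ)) ∞ (oneFormSection α) (closure (Ω : Set X)) x)
    (hL2 : ∫⁻ x in (Ω : Set X), ENNReal.ofReal ((PseudoRiemannianMetric.ofRiemannian h).innerDual
      x (α x).toLinearMap (α x).toLinearMap) ∂(riemannianMeasure h) < ⊤)
    (hsymm : ∀ x ∈ (Ω : Set X),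
      ((PseudoRiemannianMetric.ofRiemannian h).covDerivOneForm α x).IsSymm)
    (htr : ∀ x ∈ (Ω : Set X), (PseudoRiemannianMetric.ofRiemannian h).trace x
      ((PseudoRiemannianMetric.ofRiemannian h).covDerivOneForm α x) = 0)
    (hbd : ∀ γ : ℝ → X, MDifferentiableAt 𝓘(ℝ, ℝ) I γ 0 →
      (∀ᶠ t in 𝓝 (0 : ℝ), γ t ∈ frontier (Ω : Set X)) → α (γ 0) (mfderiv 𝓘(ℝ, ℝ) I γ 0 1) = 0) :
    IsRelativeL2HarmonicOneForm h Ω (extendByZero Ω α) := by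
  have hev : ∀ {x : X}, x ∈ (Ω : Set X) → ∀ᶠ y in 𝓝 x, extendByZero Ω α y = α y := fun hx ↦
    Filter.eventually_of_mem (Ω.isOpen.mem_nhds hx)
      fun y hy ↦ extendByZero_of_mem (subset_closure hy)
  refine ⟨fun x hx ↦ extendByZero_of_not_mem hx, fun x hx ↦ ?_, ?_, fun x hx ↦ ?_, fun x hx ↦ ?_,
    fun γ hγ hγ' ↦ ?_⟩
  · exact (hs x hx).congr (fun y hy ↦ by simp [oneFormSection, extendByZero_of_mem hy])
      (by simp [oneFormSection, extendByZero_of_mem hx])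
  · refine lt_of_le_of_lt (le_of_eq (setLIntegral_congr_fun Ω.isOpen.measurableSet
      fun y hy ↦ ?_)) hL2
    simp only [extendByZero_of_mem (subset_closure hy)]
  · rw [covDerivOneForm_congr_of_eventuallyEq (hev hx)]
    exact hsymm x hx
  · rw [covDerivOneForm_congr_of_eventuallyEq (hev hx)]
    exact htr x hx
  · rw [extendByZero_of_mem (frontier_subset_closure hγ'.self_of_nhds)]
    exact hbd γ hγ hγ'

variable (h Ω) in
/-- The **dimension `dim_ℝ ℋ¹_rel(Ω, h)`** of the space of relative `L²` harmonic `1`-forms, as a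
cardinal (`Module.rank`); finite e.g. under a Sobolev inequality with `Ric₋ ∈ L^{n/2}`
(Carron 1999). Carron 2007, §1.3 (`dim ℋᵏ_rel(Ω) < ∞ ⇒ dim ℋᵏ₂(M) < ∞`).
[cite: Carron2007, §1.3] -/
abbrev relativeL2HarmonicOneFormsRank : Cardinal :=
  Module.rank ℝ (relativeL2HarmonicOneForms h Ω)

/-- **Lower bound by independent members**: `m` linearly independent relative `L²` harmonic
`1`-forms give `m ≤ dim ℋ¹_rel(Ω, h)` (the shape of the flux-form lower bound: `m` boundary
components give `m` independent members `du_j`). [folklore] -/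
theorem le_rank_of_linearIndependent {m : ℕ} {v : Fin m → Π x : X, TangentSpace I x →L[ℝ] ℝ}
    (hv : ∀ i, IsRelativeL2HarmonicOneForm h Ω (v i)) (hli : LinearIndependent ℝ v) :
    (m : Cardinal) ≤ relativeL2HarmonicOneFormsRank h Ω := by
  let w : Fin m → relativeL2HarmonicOneForms h Ω := fun i ↦ ⟨v i, hv i⟩
  have hw : LinearIndependent ℝ w :=
    LinearIndependent.of_comp (relativeL2HarmonicOneForms h Ω).subtype hli
  simpa [w] using hw.cardinal_lift_le_rank

/-- Finite-dimensional form of `le_rank_of_linearIndependent`: if `ℋ¹_rel(Ω, h)` is finite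
dimensional, `m` independent members give `m ≤ finrank ℝ ℋ¹_rel(Ω, h)`. [folklore] -/
theorem le_finrank_of_linearIndependent [Module.Finite ℝ (relativeL2HarmonicOneForms h Ω)]
    {m : ℕ} {v : Fin m → Π x : X, TangentSpace I x →L[ℝ] ℝ}
    (hv : ∀ i, IsRelativeL2HarmonicOneForm h Ω (v i)) (hli : LinearIndependent ℝ v) :
    m ≤ Module.finrank ℝ (relativeL2HarmonicOneForms h Ω) := by
  let w : Fin m → relativeL2HarmonicOneForms h Ω := fun i ↦ ⟨v i, hv i⟩
  have hw : LinearIndependent ℝ w :=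
    LinearIndependent.of_comp (relativeL2HarmonicOneForms h Ω).subtype hli
  simpa using hw.fintype_card_le_finrank

end Relative

/-! ### Specialisation to initial data sets -/

/-- `ℋ¹_rel(Ω, h)` for the metric `h` of an initial data set `D = (h, k)` under the data set's own
standing hypothesis `[D.metric.HasLeviCivita]` (`D.metric` is `ofRiemannian D.h` by definition, so
the instance is transported by `rfl`; use this form, or
`haveI : (ofRiemannian D.h).HasLeviCivita := ‹D.metric.HasLeviCivita›`, in statements about data
sets such as the census items of route `HarmonicFluxCensus`). [folklore] -/
abbrev _root_.Literature.Geometry.Lorentzian.InitialDataSet.relativeL2HarmonicOneForms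
    [FiniteDimensional ℝ E] [T3Space X] [MeasurableSpace X] [BorelSpace X]
    (D : InitialDataSet I X) [D.metric.HasLeviCivita] (Ω : TopologicalSpace.Opens X) :
    Submodule ℝ (Π x : X, TangentSpace I x →L[ℝ] ℝ) :=
  haveI : (PseudoRiemannianMetric.ofRiemannian D.h).HasLeviCivita := ‹D.metric.HasLeviCivita›
  Literature.Geometry.Riemannian.relativeL2HarmonicOneForms D.h Ω

end Literature.Geometry.Riemannian

end
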